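import Summits.Ventures.Crystal3D.Theorems.StickyWulffConstantPolycrystalWulffBoundGapSlabFeas
import Summits.Ventures.Crystal3D.Theorems.StickyWulffConstantPolycrystalWulffBoundGapSlabPieces
import Summits.Ventures.Crystal3D.Theorems.StickyWulffConstantPolycrystalWulffBoundRungGapCells

/-!
# `PolycrystalWulffBound`, line `PolyDensity`: the rung `rung_gapSlabForest` — single-axis textures cut by
# basal planes into slabs whose IN-SLAB wall graphs are forests satisfy the gap-sorted bound with every
# twin wall charged `(2/√6)|⟪w, ν⟫| ≤ (1/√6)·sin∠ ≤ ½·sin∠` for ITS OWN `w` (crux `stmt-Ventures-19482`)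

Route `StickyWulffConstant` of the venture `Summits/Ventures/Crystal3D`, second prover lane (poly-p2,
gen 14).  An instance of the reduction `rung_gapCells` whose gap feasibility is PROVED (memo P-GAP-g14
§6.7).  PRESENTATION: `L` slabs `{hgt i < ⟪x, m⟫ < hgt (i+1)}`, each holding `M+1` cells (pad with empty
cells) indexed `Fin L × Fin (M+1)` and flattened by `divNat`/`modNat`; all frames pairwise co-axial about
`m`; separating planes for all pairs (`nv`, `b` antisymmetric, `Q_g ⊆ {⟪nv g g', x⟫ < b g g'}`), with
`nv g g' = m` whenever `g` lies in a lower slab than `g'`; in each slab a TREE `par i` on `Fin (M+1)`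
(root `0`, child `c.succ` hangs off `par i c`), each tree edge either same-lattice (gap `0`) or carrying
a horizontal bond `u` and a unit `w ⊥ m, u` (gap `θ i c = (2/√6)|⟪w, ν⟫|`, `ν` the edge's normal);
trims `t ≥ 0` supplied by the consumer with `θ i c ≤ t child parent` and `2√5 ≤ t g g' + t g' g` on
same-slab pairs that are not tree edges (there a separating plane meeting the cells in an edge or not
at all makes the charge `t·facetArea` vanish).  CONCLUSION: `6·2^{1/3}(√2·Vol)^{2/3} ≤ Fr + Σ_{g≠g'}
t g g'·facetArea(cl Q_g ∩ plane_{gg'})`.  FEASIBILITY: basal cuts at the common z-quantiles (one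
threshold per plane), in-slab trees by `slabTree_targets` in the slab pieces `W(A) ∩ {α_i ≤ ⟪y,m⟫ ≤ α_{i+1}}`
with the slab-restricted shift `capShift_slab_of_coaxial` — NO azimuth test (each wall picks its `w`).
WHAT THIS IS NOT: in-slab cycles; the `En` form (use `rung_gapCells_texture`); the crux is not claimed.
-/

noncomputable section

open scoped BigOperators InnerProductSpace ENNReal Pointwise
open MeasureTheory Filter Set

namespace Summit.Ventures.Crystal3D.Cruxes.PolycrystalWulffBound.PolyDensity

open Summit.Ventures.Crystal3D.Theorems
open Summit.Ventures.Crystal3D.Cruxes.TextureLiminf.TexShadow (per polytope facetArea E3)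
open Literature.MathematicalPhysics.StatisticalMechanics (fccStacking barlowStacking IsHaggSeq perimeter)

set_option maxHeartbeats 800000 in  -- one long assembly proof (slab quantiles, in-slab trees, all-pairs thresholds)
/-- **Rung `rung_gapSlabForest`** (single axis, basal slabs, in-slab forests; per-wall `w`): see the module
docstring. -/
theorem rung_gapSlabForest : let Λ : Set (EuclideanSpace ℝ (Fin 3)) := Literature.MathematicalPhysics.StatisticalMechanics.fccStacking 1 (Real.sqrt (2 / 3)); let Brl : (ℤ → ℤ) → Set (EuclideanSpace ℝ (Fin 3)) := Literature.MathematicalPhysics.StatisticalMechanics.barlowStacking 1 (Real.sqrt (2 / 3)); let Ax : EuclideanSpace ℝ (Fin 3) → (EuclideanSpace ℝ (Fin 3) ≃ₗᵢ[ℝ] EuclideanSpace ℝ (Fin 3)) → (EuclideanSpace ℝ (Fin 3) ≃ₗᵢ[ℝ] EuclideanSpace ℝ (Fin 3)) → Prop := fun m A B => ∃ (L : EuclideanSpace ℝ (Fin 3) ≃ₗᵢ[ℝ] EuclideanSpace ℝ (Fin 3)) (s₁ s₂ : EuclideanSpace ℝ (Fin 3)) (σ σ' : ℤ → ℤ), Literature.MathematicalPhysics.StatisticalMechanics.IsHaggSeq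 σ ∧ Literature.MathematicalPhysics.StatisticalMechanics.IsHaggSeq σ' ∧ L (EuclideanSpace.single (2 : Fin 3) (1 : ℝ)) = m ∧ A '' Λ ⊆ (fun q => L q + s₁) '' Brl σ ∧ B '' Λ ⊆ (fun q => L q + s₂) '' Brl σ'; let Φ : EuclideanSpace ℝ (Fin 3) → ℝ := fun ν => Real.sqrt 2 / 4 * ∑ᶠ w ∈ {w ∈ Λ | ‖w‖ = 1}, |⟪w, ν⟫_ℝ|; let Per : Set (EuclideanSpace ℝ (Fin 3)) → Set (EuclideanSpace ℝ (Fin 3)) → ℝ := fun K S => (⨆ (ξ : EuclideanSpace ℝ (Fin 3) → EuclideanSpace ℝ (Fin 3)) (_ : ContDiff ℝ 1 ξ ∧ HasCompactSupport ξ ∧ ∀ z, ξ z ∈ K), ENNReal.ofReal (∫ z in S, Literature.MathematicalPhysics.StatisticalMechanics.fieldDivergence ξ z)).toReal; let ι : Set (EuclideanSpace ℝ (Fin 3)) → Set (EuclideanSpace ℝ (Fin 3)) → Set (EuclideanSpace ℝ (Fin 3)) → ℝ := fun K S₁ S₂ => (Per K S₁ + Per K S₂ - Per K (S₁ ∪ S₂))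 / 2; let W : (EuclideanSpace ℝ (Fin 3) ≃ₗᵢ[ℝ] EuclideanSpace ℝ (Fin 3)) → Set (EuclideanSpace ℝ (Fin 3)) := fun A => {y | ∀ ν : EuclideanSpace ℝ (Fin 3), ⟪y, ν⟫_ℝ ≤ Φ (A.symm ν)}; let Vol : (n : ℕ) → (Fin n → Set (EuclideanSpace ℝ (Fin 3))) → ℝ := fun n G => (volume (⋃ f : Fin n, G f)).toReal; let Fr : (n : ℕ) → (Fin n → Set (EuclideanSpace ℝ (Fin 3))) → (Fin n → (EuclideanSpace ℝ (Fin 3) ≃ₗᵢ[ℝ] EuclideanSpace ℝ (Fin 3))) → ℝ := fun n G A => ∑ f : Fin n, Per (W (A f)) (G f) - ∑ f, ∑ g, (if f = g then 0 else ι (W (A f)) (G f) (G g)); ∀ (L M : ℕ) (H : Fin L → Fin (M + 1) → Finset ((EuclideanSpace ℝ (Fin 3)) × ℝ)) (A : Fin L → Fin (M + 1) → (EuclideanSpace ℝ (Fin 3) ≃ₗᵢ[ℝ] EuclideanSpace ℝ (Fin 3))) (nv : Fin (L * (M + 1)) → Fin (L * (M + 1)) → EuclideanSpace ℝ (Fin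 3)) (b t : Fin (L * (M + 1)) → Fin (L * (M + 1)) → ℝ) (m : EuclideanSpace ℝ (Fin 3)) (hgt : Fin (L + 1) → ℝ) (par : Fin L → Fin M → Fin (M + 1)) (θ : Fin L → Fin M → ℝ), (∀ i q, Bornology.IsBounded (⋂ p ∈ H i q, {x : EuclideanSpace ℝ (Fin 3) | ⟪p.1, x⟫_ℝ < p.2})) → (∀ i q, ∀ p ∈ H i q, ‖p.1‖ = 1) → (∀ g g', nv g' g = -nv g g') → (∀ g g', b g' g = -b g g') → (∀ g g', g ≠ g' → ‖nv g g'‖ = 1) → (∀ g g', g ≠ g' → (⋂ p ∈ H g.divNat g.modNat, {x : EuclideanSpace ℝ (Fin 3) | ⟪p.1, x⟫_ℝ < p.2}) ⊆ {x | ⟪nv g g', x⟫_ℝ < b g g'}) → (∀ i q i' q', Ax m (A i q) (A i' q')) → (∀ i q, ∀ x ∈ (⋂ p ∈ H i q, {x : EuclideanSpace ℝ (Fin 3) | ⟪p.1, x⟫_ℝ < p.2}), hgt i.castSucc < ⟪x, m⟫_ℝ ∧ ⟪x, m⟫_ℝ < hgt i.succ) → (∀ g g' : Fin (L * (M + 1)),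 g.divNat < g'.divNat → nv g g' = m) → (∀ i c, (par i c : ℕ) ≤ c) → (∀ i c, (A i (par i c) '' Λ = A i c.succ '' Λ ∧ θ i c = 0) ∨ ∃ u w : EuclideanSpace ℝ (Fin 3), u ∈ A i c.succ '' Λ ∧ ‖u‖ = 1 ∧ ⟪u, m⟫_ℝ = 0 ∧ ‖w‖ = 1 ∧ ⟪w, m⟫_ℝ = 0 ∧ ⟪w, u⟫_ℝ = 0 ∧ θ i c = 2 / Real.sqrt 6 * |⟪w, nv (finProdFinEquiv (i, par i c)) (finProdFinEquiv (i, c.succ))⟫_ℝ|) → (∀ g g', 0 ≤ t g g') → (∀ i c, θ i c ≤ t (finProdFinEquiv (i, c.succ)) (finProdFinEquiv (i, par i c))) → (∀ g g' : Fin (L * (M + 1)), g ≠ g' → g.divNat = g'.divNat → (¬ ∃ c : Fin M, (g.modNat = c.succ ∧ g'.modNat = par g.divNat c) ∨ (g'.modNat = c.succ ∧ g.modNat = par g.divNat c)) → 2 * Real.sqrt 5 ≤ t g g' + t g' g) → 6 * (2 : ℝ) ^ ((1 : ℝ) / 3) * (Real.sqrt 2 * Vol (L * (M + 1)) (fun g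 => ⋂ p ∈ H g.divNat g.modNat, {x : EuclideanSpace ℝ (Fin 3) | ⟪p.1, x⟫_ℝ < p.2})) ^ ((2 : ℝ) / 3) ≤ Fr (L * (M + 1)) (fun g => ⋂ p ∈ H g.divNat g.modNat, {x : EuclideanSpace ℝ (Fin 3) | ⟪p.1, x⟫_ℝ < p.2}) (fun g => A g.divNat g.modNat) + ∑ g, ∑ g', (if g = g' then 0 else t g g' * facetArea (closure (⋂ p ∈ H g.divNat g.modNat, {x : EuclideanSpace ℝ (Fin 3) | ⟪p.1, x⟫_ℝ < p.2}) ∩ {x | ⟪nv g g', x⟫_ℝ = b g g'}) (nv g g')) := by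
  intro Λ Brl Ax Φ Per ι W Vol Fr L M H A nv b t m hgt par θ hbd hunitH hanti hbanti hunit hsep hAx hslab
    hnvm hpar hkind ht0 htree hother
  classical
  -- flattening
  have hdm : ∀ i q, (finProdFinEquiv (i, q) : Fin (L * (M + 1))).divNat = i ∧
      (finProdFinEquiv (i, q) : Fin (L * (M + 1))).modNat = q := by
    intro i q
    have h := finProdFinEquiv.symm_apply_apply (i, q)
    rw [finProdFinEquiv_symm_apply] at h
    exact ⟨congrArg Prod.fst h, congrArg Prod.snd h⟩
  have hmk : ∀ g : Fin (L * (M + 1)), finProdFinEquiv (g.divNat, g.modNat) = g := fun g => by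
    have h := finProdFinEquiv.apply_symm_apply g
    rwa [finProdFinEquiv_symm_apply] at h
  set Q : Fin (L * (M + 1)) → Set E3 := fun g => ⋂ p ∈ H g.divNat g.modNat, {x : E3 | ⟪p.1, x⟫_ℝ < p.2}
    with hQ
  -- degenerate case: no cells
  rcases Nat.eq_zero_or_pos (L * (M + 1)) with hN0 | hNpos
  · have hL0 : ∀ g : Fin (L * (M + 1)), False := fun g => absurd g.isLt (by omega)
    exact rung_gapCells (L * (M + 1)) (fun g => H g.divNat g.modNat) (fun g => A g.divNat g.modNat) nv b
      (fun _ _ => 0) t (fun g => hbd _ _) (fun g => hunitH _ _) (fun g g' => hanti g g')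
      (fun g g' => hbanti g g') hunit hsep ht0 (fun g => (hL0 g).elim) (fun g => (hL0 g).elim)
  obtain ⟨g₀⟩ : Nonempty (Fin (L * (M + 1))) := ⟨⟨0, hNpos⟩⟩
  have hm1 : ‖m‖ = 1 := by
    obtain ⟨L', -, -, -, -, -, -, hLm, -, -⟩ := hAx g₀.divNat g₀.modNat g₀.divNat g₀.modNat
    rw [← hLm, LinearIsometryEquiv.norm_map, PiLp.norm_single, norm_one]
  -- bodies
  have hWc : ∀ X : E3 ≃ₗᵢ[ℝ] E3, IsCompact (W X) := fun X => isCompact_cruxWulffBody X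
  have hWm : ∀ X : E3 ≃ₗᵢ[ℝ] E3, MeasurableSet (W X) := fun X => (hWc X).isClosed.measurableSet
  have hW5 : ∀ X : E3 ≃ₗᵢ[ℝ] E3, W X ⊆ Metric.closedBall (0 : E3) (Real.sqrt 5) :=
    fun X => cruxWulffBody_subset_closedBall X
  have hcapeq : ∀ i q i' q' (a : ℝ), volume (W (A i q) ∩ {y : E3 | a < ⟪y, m⟫_ℝ}) =
      volume (W (A i' q') ∩ {y : E3 | a < ⟪y, m⟫_ℝ}) := by
    intro i q i' q' a
    obtain ⟨L', s₁, s₂, σ, σ', hσ, hσ', hLm, h1, h2⟩ := hAx i' q' i q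
    exact volume_cruxWulffBody_inter_eq_of_coaxial ⟨L', s₁, s₁, σ, σ, hσ, hσ, hLm, h1, h1⟩
      ⟨L', s₂, s₂, σ', σ', hσ', hσ', hLm, h2, h2⟩ a
  -- volumes of cells and slabs
  have hvolQ : ∀ g, volume (Q g) < ⊤ := fun g => (hbd g.divNat g.modNat).measure_lt_top
  set V : ℝ := (volume (⋃ g, Q g)).toReal with hV
  have hV0 : 0 ≤ V := ENNReal.toReal_nonneg
  set vq : Fin L → Fin (M + 1) → ℝ := fun i q => (volume (Q (finProdFinEquiv (i, q)))).toReal with hvq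
  have hvq0 : ∀ i q, 0 ≤ vq i q := fun i q => ENNReal.toReal_nonneg
  set Sv : Fin L → ℝ := fun i => ∑ q, vq i q with hSv
  have hSv0 : ∀ i, 0 ≤ Sv i := fun i => Finset.sum_nonneg fun q _ => hvq0 i q
  -- upper cumulative slab volumes `Rv i = Σ_{i' ≥ i} Sv i'` (as a function on `Fin (L+1)`)
  set Rv : Fin (L + 1) → ℝ := fun i => ∑ i' ∈ Finset.univ.filter (fun i' : Fin L => (i : ℕ) ≤ i'), Sv i'
    with hRv
  have hRv0 : ∀ i, 0 ≤ Rv i := fun i => Finset.sum_nonneg fun i' _ => hSv0 i'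
  have hdisjQ : ∀ g g', g ≠ g' → Disjoint (Q g) (Q g') := by
    intro g g' hgg'
    rw [Set.disjoint_left]
    intro x hx hx'
    have h1 : ⟪nv g g', x⟫_ℝ < b g g' := hsep g g' hgg' hx
    have h2 : ⟪nv g' g, x⟫_ℝ < b g' g := hsep g' g (Ne.symm hgg') hx'
    rw [hanti g g', hbanti g g', inner_neg_left] at h2
    linarith
  have hVsum : V = ∑ i, Sv i := by
    have hQm : ∀ g, MeasurableSet (Q g) := fun g =>
      (isOpen_biInter_finset fun q _ => isOpen_lt (continuous_const.inner continuous_id) continuous_const).measurableSet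
    rw [hV, measure_iUnion (fun g g' h => hdisjQ g g' h) hQm, tsum_fintype,
      ENNReal.toReal_sum (fun g _ => (hvolQ g).ne)]
    rw [Fintype.sum_equiv finProdFinEquiv.symm (fun g => (volume (Q g)).toReal) (fun p => vq p.1 p.2)
      (fun g => by simp only [hvq, finProdFinEquiv_symm_apply, hmk]), Fintype.sum_prod_type]
  have hRvle : ∀ i, Rv i ≤ V := by
    intro i; rw [hVsum]
    exact Finset.sum_le_sum_of_subset_of_nonneg (Finset.filter_subset _ _) fun i' _ _ => hSv0 i'
  -- fractions and monotone cut heights in the reference body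
  set A₀ : E3 ≃ₗᵢ[ℝ] E3 := A g₀.divNat g₀.modNat with hA₀
  set ρ : Fin (L + 1) → ℝ := fun i => Rv i / V with hρ
  have hρ0 : ∀ i, 0 ≤ ρ i := fun i => div_nonneg (hRv0 i) hV0
  have hρ1 : ∀ i, ρ i ≤ 1 := by
    intro i; rw [hρ]
    by_cases hV00 : V = 0
    · simp [hV00]
    · exact (div_le_one (lt_of_le_of_ne hV0 (Ne.symm hV00))).2 (hRvle i)
  have hRvanti : ∀ i j : Fin (L + 1), i ≤ j → Rv j ≤ Rv i := by
    intro i j hij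
    simp only [hRv]
    exact Finset.sum_le_sum_of_subset_of_nonneg
      (fun i' hi' => by
        rw [Finset.mem_filter] at hi' ⊢
        exact ⟨hi'.1, le_trans (by exact_mod_cast hij) hi'.2⟩)
      fun i' _ _ => hSv0 i'
  have hρanti : ∀ i j : Fin (L + 1), i ≤ j → ρ j ≤ ρ i := fun i j hij =>
    div_le_div_of_nonneg_right (hRvanti i j hij) hV0
  obtain ⟨α, hαmono, hα⟩ := exists_mono_capHeights A₀ hm1 ρ hρ0 hρ1 hρanti
  -- `Rv i.castSucc = Sv i + Rv i.succ`
  have hRvsucc : ∀ i : Fin L, Rv i.castSucc = Sv i + Rv i.succ := by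
    intro i
    simp only [hRv]
    have hsplit : Finset.univ.filter (fun i' : Fin L => ((i.castSucc : Fin (L + 1)) : ℕ) ≤ i') =
        insert i (Finset.univ.filter (fun i' : Fin L => ((i.succ : Fin (L + 1)) : ℕ) ≤ i')) := by
      ext i'
      simp only [Finset.mem_filter, Finset.mem_univ, true_and, Finset.mem_insert, Fin.val_castSucc,
        Fin.val_succ]
      constructor
      · intro h
        by_cases h' : i' = i
        · exact Or.inl h'
        · right
          have : (i : ℕ) ≠ i' := fun h'' => h' (Fin.ext h''.symm)
          omega
      · rintro (rfl | h)
        · exact le_rfl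
        · omega
    rw [hsplit, Finset.sum_insert (by simp [Fin.val_succ])]
  -- the slab pieces `Kc i q = W(A i q) ∩ {⟪y,m⟫ ∈ [α lo, α hi]}` and their volumes
  set Kc : Fin L → Fin (M + 1) → Set E3 := fun i q =>
    W (A i q) ∩ {y : E3 | ⟪y, m⟫_ℝ ∈ Icc (α i.castSucc) (α i.succ)} with hKc
  have hKcc : ∀ i q, IsCompact (Kc i q) := fun i q =>
    (hWc _).inter_right (isClosed_Icc.preimage (continuous_id.inner continuous_const))
  have hKc5 : ∀ i q, Kc i q ⊆ Metric.closedBall (0 : E3) (Real.sqrt 5) :=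
    fun i q => inter_subset_left.trans (hW5 _)
  have hKcvol : ∀ i q, volume (Kc i q) = ENNReal.ofReal (32 * (Sv i / V)) := by
    intro i q
    have hlohi : α i.castSucc ≤ α i.succ := hαmono (Fin.castSucc_le_succ i)
    have h1 := volume_cruxWulffBody_slabPiece (A i q) hm1 hlohi
    have hlo : volume (W (A i q) ∩ {y : E3 | α i.castSucc < ⟪y, m⟫_ℝ}) = ENNReal.ofReal (32 * ρ i.castSucc) := by
      rw [hcapeq i q g₀.divNat g₀.modNat]; exact hα i.castSucc
    have hhi : volume (W (A i q) ∩ {y : E3 | α i.succ < ⟪y, m⟫_ℝ}) = ENNReal.ofReal (32 * ρ i.succ) := by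
      rw [hcapeq i q g₀.divNat g₀.modNat]; exact hα i.succ
    show volume (W (A i q) ∩ {y : E3 | ⟪y, m⟫_ℝ ∈ Icc (α i.castSucc) (α i.succ)}) = _
    rw [h1, hlo, hhi, ← ENNReal.ofReal_sub _ (by nlinarith [hρ0 i.succ])]
    congr 1
    have e1 : ρ i.castSucc = Rv i.castSucc / V := rfl
    have e2 : ρ i.succ = Rv i.succ / V := rfl
    rw [e1, e2, hRvsucc i]; ring
  -- in-slab trees
  set gp : Fin L → Fin M → Fin (L * (M + 1)) := fun i c => finProdFinEquiv (i, par i c) with hgp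
  set gc : Fin L → Fin M → Fin (L * (M + 1)) := fun i c => finProdFinEquiv (i, c.succ) with hgc
  have hgpc : ∀ i c, gp i c ≠ gc i c := by
    intro i c h
    have h1 : (i, par i c) = (i, c.succ) := finProdFinEquiv.injective h
    have h2 : par i c = c.succ := congrArg Prod.snd h1
    have h3 := hpar i c
    rw [h2, Fin.val_succ] at h3
    omega
  set ν : Fin L → Fin M → E3 := fun i c => nv (gp i c) (gc i c) with hν
  have hν1 : ∀ i c, ‖ν i c‖ = 1 := fun i c => hunit _ _ (hgpc i c)
  have hθ0 : ∀ i c, 0 ≤ θ i c := by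
    intro i c
    rcases hkind i c with ⟨-, h⟩ | ⟨u, w, -, -, -, -, -, -, h⟩
    · rw [h]
    · rw [h]; positivity
  have hshift : ∀ i c (s : ℝ), volume (Kc i (par i c) ∩ {y : E3 | s + θ i c < ⟪y, ν i c⟫_ℝ}) ≤
      volume (Kc i c.succ ∩ {y : E3 | s < ⟪y, ν i c⟫_ℝ}) := by
    intro i c s
    rcases hkind i c with ⟨hΛ, h⟩ | ⟨u, w, hu, hu1, hum, hw, hwm, hwu, h⟩
    · have hWeq : W (A i (par i c)) = W (A i c.succ) := wulffBody_eq_of_image_eq hΛ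
      rw [h, add_zero]
      show volume (W (A i (par i c)) ∩ {y : E3 | ⟪y, m⟫_ℝ ∈ Icc (α i.castSucc) (α i.succ)} ∩
          {y : E3 | s < ⟪y, ν i c⟫_ℝ}) ≤
        volume (W (A i c.succ) ∩ {y : E3 | ⟪y, m⟫_ℝ ∈ Icc (α i.castSucc) (α i.succ)} ∩
          {y : E3 | s < ⟪y, ν i c⟫_ℝ})
      rw [hWeq]
    · rw [h]
      exact capShift_slab_of_coaxial (hAx i (par i c) i c.succ) hu hu1 hum hw hwm hwu measurableSet_Icc
        (ν i c) s
  have htargets : ∀ i, ∃ sIn : Fin M → ℝ, ∀ q, ENNReal.ofReal (32 * (vq i q / V)) ≤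
      volume (Kc i q ∩ ((⋂ c ∈ Finset.univ.filter (fun c => par i c = q),
        {y : E3 | ⟪y, ν i c⟫_ℝ ≤ sIn c + θ i c}) ∩
        ⋂ c ∈ Finset.univ.filter (fun c : Fin M => q = c.succ), {y : E3 | sIn c < ⟪y, ν i c⟫_ℝ})) := by
    intro i
    exact slabTree_targets (par i) (hpar i) (Kc i) (hKcc i) (Real.sqrt_nonneg 5) (hKc5 i)
      (div_nonneg (hSv0 i) hV0) (hKcvol i) (ν i) (hν1 i) (θ i) (hshift i) (fun q => vq i q / V)
      (fun q => div_nonneg (hvq0 i q) hV0)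
      (by show ∑ q, vq i q / V = (∑ q, vq i q) / V; rw [Finset.sum_div])
  choose sIn hsIn using htargets
  -- thresholds for the reduction
  set τIn : Fin L → Fin (M + 1) → Fin (M + 1) → ℝ := fun i q q' =>
    if hq : ∃ c : Fin M, q = c.succ ∧ par i c = q' then - sIn i (Classical.choose hq)
    else if hq' : ∃ c : Fin M, q' = c.succ ∧ par i c = q then
      sIn i (Classical.choose hq') + θ i (Classical.choose hq')
    else Real.sqrt 5 with hτIn
  set τ : Fin (L * (M + 1)) → Fin (L * (M + 1)) → ℝ := fun g g' =>
    if g.divNat < g'.divNat then α (g.divNat).succ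
    else if g'.divNat < g.divNat then - α (g.divNat).castSucc
    else τIn g.divNat g.modNat g'.modNat with hτ
  -- uniqueness of the child index
  have hchoose : ∀ i (q q' : Fin (M + 1)) (hq : ∃ c : Fin M, q = c.succ ∧ par i c = q') (c : Fin M),
      q = c.succ → Classical.choose hq = c := by
    intro i q q' hq c hc
    have h1 := (Classical.choose_spec hq).1
    exact Fin.succ_inj.1 (h1.symm.trans hc)
  have hnotboth : ∀ i (q q' : Fin (M + 1)), (∃ c : Fin M, q = c.succ ∧ par i c = q') →
      ¬ (∃ c : Fin M, q' = c.succ ∧ par i c = q) := by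
    rintro i q q' ⟨c, hc, hpc⟩ ⟨c', hc', hpc'⟩
    have h1 := hpar i c
    have h2 := hpar i c'
    rw [hpc] at h1; rw [hpc'] at h2
    rw [hc', Fin.val_succ] at h1; rw [hc, Fin.val_succ] at h2
    omega
  -- the gap condition
  have hgap : ∀ g g', g ≠ g' → τ g g' + τ g' g ≤ t g g' + t g' g := by
    intro g g' hgg'
    have ht1 := ht0 g g'; have ht2 := ht0 g' g
    by_cases h1 : g.divNat < g'.divNat
    · have h2 : ¬ g'.divNat < g.divNat := fun h => lt_asymm h1 h
      simp only [hτ, if_pos h1, if_neg h2]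
      have := hαmono (show (g.divNat).succ ≤ (g'.divNat).castSucc from by
        rw [Fin.le_iff_val_le_val, Fin.val_succ, Fin.val_castSucc]; omega)
      linarith
    by_cases h2 : g'.divNat < g.divNat
    · simp only [hτ, if_neg h1, if_pos h2]
      have := hαmono (show (g'.divNat).succ ≤ (g.divNat).castSucc from by
        rw [Fin.le_iff_val_le_val, Fin.val_succ, Fin.val_castSucc]; omega)
      linarith
    -- same slab
    have hii : g.divNat = g'.divNat := le_antisymm (not_lt.1 h2) (not_lt.1 h1)
    have hqq : g.modNat ≠ g'.modNat := by
      intro h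
      exact hgg' (by rw [← hmk g, ← hmk g', hii, h])
    simp only [hτ, if_neg h1, if_neg h2]
    rw [← hii]
    set i := g.divNat
    set q := g.modNat
    set q' := g'.modNat
    by_cases hA1 : ∃ c : Fin M, q = c.succ ∧ par i c = q'
    · obtain ⟨c, hc, hpc⟩ := hA1
      have hB : ¬ ∃ c : Fin M, q' = c.succ ∧ par i c = q := hnotboth i q q' ⟨c, hc, hpc⟩
      have hA2 : ∃ c : Fin M, q = c.succ ∧ par i c = q' := ⟨c, hc, hpc⟩
      have e1 : τIn i q q' = - sIn i c := by
        simp only [hτIn, dif_pos hA2, hchoose i q q' hA2 c hc]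
      have e2 : τIn i q' q = sIn i c + θ i c := by
        simp only [hτIn, dif_neg hB, dif_pos hA2, hchoose i q q' hA2 c hc]
      rw [e1, e2]
      have hg : finProdFinEquiv (i, c.succ) = g := by rw [← hc]; exact hmk g
      have hg' : finProdFinEquiv (i, par i c) = g' := by rw [hpc, hii]; exact hmk g'
      have := htree i c
      rw [hg, hg'] at this
      linarith
    by_cases hB1 : ∃ c : Fin M, q' = c.succ ∧ par i c = q
    · obtain ⟨c, hc, hpc⟩ := hB1
      have hB2 : ∃ c : Fin M, q' = c.succ ∧ par i c = q := ⟨c, hc, hpc⟩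
      have hA : ¬ ∃ c : Fin M, q = c.succ ∧ par i c = q' := hA1
      have e1 : τIn i q q' = sIn i c + θ i c := by
        simp only [hτIn, dif_neg hA, dif_pos hB2, hchoose i q' q hB2 c hc]
      have e2 : τIn i q' q = - sIn i c := by
        simp only [hτIn, dif_pos hB2, hchoose i q' q hB2 c hc]
      rw [e1, e2]
      have hg' : finProdFinEquiv (i, c.succ) = g' := by rw [← hc, hii]; exact hmk g'
      have hg : finProdFinEquiv (i, par i c) = g := by rw [hpc]; exact hmk g
      have := htree i c
      rw [hg, hg'] at this
      linarith
    · have e1 : τIn i q q' = Real.sqrt 5 := by simp only [hτIn, dif_neg hA1, dif_neg hB1]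
      have e2 : τIn i q' q = Real.sqrt 5 := by
        have hA' : ¬ ∃ c : Fin M, q' = c.succ ∧ par i c = q := hB1
        have hB' : ¬ ∃ c : Fin M, q = c.succ ∧ par i c = q' := hA1
        simp only [hτIn, dif_neg hA', dif_neg hB']
      rw [e1, e2]
      have hno : ¬ ∃ c : Fin M, (g.modNat = c.succ ∧ g'.modNat = par g.divNat c) ∨
          (g'.modNat = c.succ ∧ g.modNat = par g.divNat c) := by
        rintro ⟨c, (⟨hc, hpc⟩ | ⟨hc, hpc⟩)⟩
        · exact hA1 ⟨c, hc, hpc.symm⟩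
        · exact hB1 ⟨c, hc, hpc.symm⟩
      have := hother g g' hgg' hii hno
      linarith
  -- feasibility of the thresholds
  have hfeas : ∀ g, ENNReal.ofReal (32 * ((volume (Q g)).toReal / V)) ≤
      volume (W (A g.divNat g.modNat) ∩ ⋂ g' ∈ Finset.univ.filter (fun g' => g' ≠ g),
        {y : E3 | ⟪y, nv g g'⟫_ℝ ≤ τ g g'}) := by
    intro g
    set i := g.divNat with hi
    set q := g.modNat with hq
    have hvq_eq : vq i q = (volume (Q g)).toReal := by
      show (volume (Q (finProdFinEquiv (i, q)))).toReal = _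
      rw [hi, hq, hmk g]
    have h0 := hsIn i q
    rw [hvq_eq] at h0
    refine h0.trans (measure_mono ?_)
    rintro y ⟨⟨hyW, hyI⟩, hyC, hyO⟩
    rw [mem_setOf_eq, mem_Icc] at hyI
    refine ⟨hyW, ?_⟩
    simp only [mem_iInter, Finset.mem_filter, Finset.mem_univ, true_and, mem_setOf_eq]
    intro g' hg'
    have hy5 : ‖y‖ ≤ Real.sqrt 5 := mem_closedBall_zero_iff.1 (hW5 _ hyW)
    by_cases h1 : g.divNat < g'.divNat
    · simp only [hτ, if_pos h1]
      rw [hnvm g g' h1]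
      exact hyI.2
    by_cases h2 : g'.divNat < g.divNat
    · simp only [hτ, if_neg h1, if_pos h2]
      rw [hanti g' g, hnvm g' g h2, inner_neg_right]
      linarith [hyI.1]
    have hii : g.divNat = g'.divNat := le_antisymm (not_lt.1 h2) (not_lt.1 h1)
    simp only [hτ, if_neg h1, if_neg h2]
    set q' := g'.modNat with hq'
    by_cases hA1 : ∃ c : Fin M, q = c.succ ∧ par i c = q'
    · obtain ⟨c, hc, hpc⟩ := hA1
      have hA2 : ∃ c : Fin M, q = c.succ ∧ par i c = q' := ⟨c, hc, hpc⟩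
      have e1 : τIn i q q' = - sIn i c := by
        simp only [hτIn, dif_pos hA2, hchoose i q q' hA2 c hc]
      rw [e1]
      have hg : finProdFinEquiv (i, c.succ) = g := by rw [← hc]; exact hmk g
      have hg' : finProdFinEquiv (i, par i c) = g' := by rw [hpc, hi, hii]; exact hmk g'
      have hn : nv g g' = - ν i c := by
        show nv g g' = -nv (finProdFinEquiv (i, par i c)) (finProdFinEquiv (i, c.succ))
        rw [hg, hg']; exact hanti g' g
      rw [hn, inner_neg_right]
      have hyo : sIn i c < ⟪y, ν i c⟫_ℝ := by
        have := (mem_iInter₂.1 hyO) c (Finset.mem_filter.2 ⟨Finset.mem_univ _, hc⟩)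
        exact this
      linarith
    by_cases hB1 : ∃ c : Fin M, q' = c.succ ∧ par i c = q
    · obtain ⟨c, hc, hpc⟩ := hB1
      have hB2 : ∃ c : Fin M, q' = c.succ ∧ par i c = q := ⟨c, hc, hpc⟩
      have e1 : τIn i q q' = sIn i c + θ i c := by
        simp only [hτIn, dif_neg hA1, dif_pos hB2, hchoose i q' q hB2 c hc]
      rw [e1]
      have hg' : finProdFinEquiv (i, c.succ) = g' := by rw [← hc, hi, hii]; exact hmk g'
      have hg : finProdFinEquiv (i, par i c) = g := by rw [hpc]; exact hmk g
      have hn : nv g g' = ν i c := by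
        show nv g g' = nv (finProdFinEquiv (i, par i c)) (finProdFinEquiv (i, c.succ))
        rw [hg, hg']
      rw [hn]
      exact (mem_iInter₂.1 hyC) c (Finset.mem_filter.2 ⟨Finset.mem_univ _, hpc⟩)
    · have e1 : τIn i q q' = Real.sqrt 5 := by simp only [hτIn, dif_neg hA1, dif_neg hB1]
      rw [e1]
      have h3 : ⟪y, nv g g'⟫_ℝ ≤ ‖y‖ * ‖nv g g'‖ := real_inner_le_norm _ _
      rw [hunit g g' (Ne.symm hg'), mul_one] at h3
      linarith
  -- the reduction
  exact rung_gapCells (L * (M + 1)) (fun g => H g.divNat g.modNat) (fun g => A g.divNat g.modNat) nv b τ t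
    (fun g => hbd _ _) (fun g => hunitH _ _) (fun g g' => hanti g g') (fun g g' => hbanti g g') hunit hsep
    ht0 hgap hfeas

end Summit.Ventures.Crystal3D.Cruxes.PolycrystalWulffBound.PolyDensity

end
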